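import Mathlib
import Summits.MatrixMultiplication.Statement
import Summits.MatrixMultiplication.MatrixMultiplication.Theorems.GraphEquationsTowerFrame

/-!
# Graph equations — first-order Taylor coefficients and the section polynomial (M24b)

Three bookkeeping tools for assembling the S1 binder from the specialised identity tower
(NODE-g36 §3, files E3/S4):

* `coeff_single_bind₁_taylor` — the FIRST-ORDER TAYLOR FORMULA for a substitution: the coefficient of `X y`
  in `bind₁ θ g` is `∑_v (∂_v g)(θ(0)) · coeff_{X y} (θ v)` (any `θ`; used with the affine recentring
  `θ₁` to identify the linear parts of `τ` with fibre gradients at the `ℂ`-point);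
  `constantCoeff_bind₁` — the constant term is `g (θ(0))`;
* `bind₁_mem_freeSpan_empty` — cost-free (affine) substitutions preserve cost-free polynomials;
* `secPoly g` — `g (a, b, ab, y)` as a polynomial in the kernel variables `y` with coefficients in
  `ℂ[a,b]`, with `eval₂_secPoly`: under a `ℂ`-algebra hom `φ : ℂ[a,b] → B`,
  `eval₂ φ s (secPoly g) = aeval (Sum.elim (φ ∘ graphRestrict ∘ X) s) g`; in particular
  `aeval (towerPt lam) g = eval₂ (algebraMap _ K) lam (secPoly g)` (`aeval_towerPt_eq_eval₂_secPoly`).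
-/

set_option linter.dupNamespace false

noncomputable section

open scoped BigOperators

namespace Summit.MatrixMultiplication.MatrixMultiplication.Theorems.GraphEquations

open MvPolynomial
open Literature.Computability.AlgebraicComplexity

section Taylor

variable {V W : Type*} {R : Type*} [CommRing R]

/-- The constant term of a substitution is the value at the constants. -/
theorem constantCoeff_bind₁ (θ : V → MvPolynomial W R) (g : MvPolynomial V R) :
    constantCoeff (bind₁ θ g) = aeval (fun v => constantCoeff (θ v)) g := by
  induction g using MvPolynomial.induction_on with
  | C a => rw [bind₁_C_right, constantCoeff_C, aeval_C]; rfl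
  | add p q hp hq => rw [map_add, map_add, map_add, hp, hq]
  | mul_X p v hp => rw [map_mul, map_mul, map_mul, bind₁_X_right, aeval_X, hp]

/-- Coefficient of `X y` of a product (Leibniz at order one). -/
theorem coeff_single_one_mul_cc [DecidableEq W] (p q : MvPolynomial W R) (y : W) :
    coeff (Finsupp.single y 1) (p * q) =
      coeff (Finsupp.single y 1) p * constantCoeff q + constantCoeff p * coeff (Finsupp.single y 1) q := by
  rw [coeff_mul, Finsupp.antidiagonal_single, Finset.sum_map, Finset.Nat.sum_antidiagonal_succ,
    Finset.Nat.antidiagonal_zero, Finset.sum_singleton]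
  simp [constantCoeff_eq, add_comm]

/-- **First-order Taylor formula for substitutions.**  For any substitution `θ` and polynomial `g`
(finitely many variables `V`): the coefficient of `X y` in `g ∘ θ` is
`∑_v (∂_v g)(θ(0)) · coeff_{X y}(θ v)`. -/
theorem coeff_single_bind₁_taylor [Fintype V] [DecidableEq V] [DecidableEq W] (θ : V → MvPolynomial W R)
    (g : MvPolynomial V R) (y : W) :
    coeff (Finsupp.single y 1) (bind₁ θ g) =
      ∑ v, aeval (fun v => constantCoeff (θ v)) (pderiv v g) * coeff (Finsupp.single y 1) (θ v) := by
  induction g using MvPolynomial.induction_on with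
  | C a =>
    rw [bind₁_C_right, coeff_C]
    have h0 : (0 : W →₀ ℕ) ≠ Finsupp.single y 1 := by
      intro h; have := Finsupp.ext_iff.mp h y; simp at this
    simp [h0]
  | add p q hp hq =>
    rw [map_add, coeff_add, hp, hq, ← Finset.sum_add_distrib]
    refine Finset.sum_congr rfl fun v _ => ?_
    rw [map_add, map_add, add_mul]
  | mul_X p v hp =>
    rw [map_mul, bind₁_X_right, coeff_single_one_mul_cc, hp, constantCoeff_bind₁]
    have hder : ∀ v', aeval (fun v => constantCoeff (θ v)) (pderiv v' (p * X v)) =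
        aeval (fun v => constantCoeff (θ v)) (pderiv v' p) * constantCoeff (θ v) +
          aeval (fun v => constantCoeff (θ v)) p * ((Pi.single v' (1 : R) : V → R) v) := by
      intro v'
      rw [pderiv_mul, pderiv_X, map_add, map_mul, map_mul, aeval_X]
      congr 2
      by_cases h : v' = v
      · subst h; simp
      · simp [h]
    simp_rw [hder, add_mul, Finset.sum_add_distrib, Finset.sum_mul]
    congr 1
    · refine Finset.sum_congr rfl fun v' _ => ?_; ring
    · rw [Finset.sum_eq_single v (fun v' _ hv' => by simp [Ne.symm hv']) (fun h => absurd (Finset.mem_univ v) h)]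
      simp

end Taylor

section CostFree

variable {V W : Type*}

/-- A cost-free polynomial is an `R`-combination of `1` and variables: characterisation of
`freeSpan ∅`. -/
theorem mem_freeSpan_empty_iff {R : Type*} [CommRing R] {p : MvPolynomial V R} :
    p ∈ freeSpan (∅ : Set (MvPolynomial V R)) ↔
      p ∈ Submodule.span R (insert (1 : MvPolynomial V R) (Set.range X)) := by
  unfold freeSpan; rw [Set.union_empty]

/-- **Cost-free substitutions preserve cost-free polynomials.** -/
theorem bind₁_mem_freeSpan_empty {R : Type*} [CommRing R] (θ : V → MvPolynomial W R)
    (hθ : ∀ v, θ v ∈ freeSpan (∅ : Set (MvPolynomial W R))) {p : MvPolynomial V R}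
    (hp : p ∈ freeSpan (∅ : Set (MvPolynomial V R))) :
    bind₁ θ p ∈ freeSpan (∅ : Set (MvPolynomial W R)) := by
  rw [mem_freeSpan_empty_iff] at hp
  refine Submodule.span_induction ?_ ?_ ?_ ?_ hp
  · rintro q (rfl | ⟨v, rfl⟩)
    · rw [map_one]; exact Submodule.subset_span (Set.mem_insert _ _)
    · rw [bind₁_X_right]; exact hθ v
  · rw [map_zero]; exact Submodule.zero_mem _
  · intro q q' _ _ hq hq'; rw [map_add]; exact Submodule.add_mem _ hq hq'
  · intro r q _ hq
    rw [map_smul]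
    exact Submodule.smul_mem _ r hq

/-- Constants are cost-free. -/
theorem C_add_mem_freeSpan_empty {R : Type*} [CommRing R] (c : R) {p : MvPolynomial V R}
    (hp : p ∈ freeSpan (∅ : Set (MvPolynomial V R))) :
    C c + p ∈ freeSpan (∅ : Set (MvPolynomial V R)) :=
  Submodule.add_mem _ (C_mem_freeSpan _ c) hp

/-- A linear form `∑_w c_w X_w` is cost-free. -/
theorem sum_smul_X_mem_freeSpan_empty {R : Type*} [CommRing R] (s : Finset V) (c : V → R) :
    (∑ w ∈ s, c w • (X w : MvPolynomial V R)) ∈ freeSpan (∅ : Set (MvPolynomial V R)) :=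
  Submodule.sum_mem _ fun w _ => Submodule.smul_mem _ _ (X_mem_freeSpan _ w)

end CostFree

section SecPoly

variable {n : ℕ}

/-- `g (a, b, ab, y)` as a polynomial in the kernel variables `y : κ` over `ℂ[a,b]`. -/
def secPoly {κ : Type*} (g : MvPolynomial (GraphVars n ⊕ κ) ℂ) :
    MvPolynomial κ (MvPolynomial (MatMulVars n) ℂ) :=
  aeval (Sum.elim (fun v => C (graphRestrict n (X v))) X) g

/-- **Evaluation of the section polynomial** under a `ℂ`-algebra hom `φ : ℂ[a,b] → B`. -/
theorem eval₂_secPoly {κ : Type*} {B : Type*} [CommRing B] [Algebra ℂ B]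
    (φ : MvPolynomial (MatMulVars n) ℂ →ₐ[ℂ] B) (s : κ → B) (g : MvPolynomial (GraphVars n ⊕ κ) ℂ) :
    eval₂ (φ : MvPolynomial (MatMulVars n) ℂ →+* B) s (secPoly g) =
      aeval (Sum.elim (fun v => φ (graphRestrict n (X v))) s) g := by
  induction g using MvPolynomial.induction_on with
  | C a =>
    rw [secPoly, aeval_C, aeval_C]
    rw [show algebraMap ℂ (MvPolynomial κ (MvPolynomial (MatMulVars n) ℂ)) a = C (C a) from rfl,
      eval₂_C]
    rw [show (C a : MvPolynomial (MatMulVars n) ℂ) = algebraMap ℂ _ a from rfl, AlgHom.coe_toRingHom,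
      AlgHom.commutes]
  | add p q hp hq =>
    rw [secPoly, map_add, eval₂_add, map_add, ← secPoly, ← secPoly, hp, hq]
  | mul_X p v hp =>
    rw [secPoly, map_mul, eval₂_mul, map_mul, ← secPoly, hp, aeval_X, aeval_X]
    congr 1
    rcases v with v | x
    · simp only [Sum.elim_inl, eval₂_C, AlgHom.coe_toRingHom]
    · simp only [Sum.elim_inr, eval₂_X]

/-- The value at the tower point is the evaluation of the section polynomial at `lam`. -/
theorem aeval_towerPt_eq_eval₂_secPoly {K : Type*} [Field K] [Algebra ℂ K]
    [Algebra (MvPolynomial (MatMulVars n) ℂ) K] [IsScalarTower ℂ (MvPolynomial (MatMulVars n) ℂ) K]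
    {κ : Type} (lam : κ → K) (g : MvPolynomial (GraphVars n ⊕ κ) ℂ) :
    aeval (towerPt lam) g =
      eval₂ (algebraMap (MvPolynomial (MatMulVars n) ℂ) K) lam (secPoly g) := by
  have h := eval₂_secPoly (IsScalarTower.toAlgHom ℂ (MvPolynomial (MatMulVars n) ℂ) K) lam g
  rw [IsScalarTower.coe_toAlgHom] at h
  rw [h]
  rfl

/-- The section polynomial of an embedded base polynomial `ι t` (`t ∈ ℂ[a,b,c]`) is the constant
`graphRestrict t`. -/
theorem secPoly_rename_inl {κ : Type*} (t : MvPolynomial (GraphVars n) ℂ) :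
    secPoly (rename Sum.inl t : MvPolynomial (GraphVars n ⊕ κ) ℂ) = C (graphRestrict n t) := by
  rw [secPoly, aeval_rename]
  have : (Sum.elim (fun v => C (graphRestrict n (X v))) X ∘ Sum.inl :
      GraphVars n → MvPolynomial κ (MvPolynomial (MatMulVars n) ℂ)) =
      fun v => C (graphRestrict n (X v)) := rfl
  rw [this]
  induction t using MvPolynomial.induction_on with
  | C a => rw [aeval_C, graphRestrict_C]; rfl
  | add p q hp hq => rw [map_add, map_add, map_add, hp, hq]
  | mul_X p v hp => rw [map_mul, aeval_X, hp, map_mul, map_mul]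

end SecPoly

end Summit.MatrixMultiplication.MatrixMultiplication.Theorems.GraphEquations

end
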